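import Mathlib.Combinatorics.SimpleGraph.DegreeSum
import Mathlib.Combinatorics.SimpleGraph.DeleteEdges
import Mathlib.Combinatorics.SimpleGraph.Connectivity.Subgraph
import Literature.Combinatorics.SimpleGraph.MooreBound
import Literature.Combinatorics.SimpleGraph.MooreBoundBalls
import Literature.Combinatorics.SimpleGraph.MooreBoundCount
import HarnessLib

/-!
# The Moore bound for irregular graphs (Alon–Hoory–Linial, Theorem 1) on a finite vertex type

Completes the series `MooreBoundWalks` / `MooreBoundBalls` / `MooreBoundCount` into a proof of
**Theorem 1 of [AlonHooryLinial2002]** for a simple graph on an arbitrary finite vertex type `V`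
(`AlonHooryLinial.mooreBound_le_card_of_egirth_eq`: girth `g`, `d ≥ 2`,
`d · |V| ≤ 2|E|` ⟹ `n₀(d, g) ≤ |V|`), following the printed proof [AlonHooryLinial2002,
pp. 54–56]:

1. `AlonHooryLinial.mooreBound_le_card` — the theorem for graphs all of whose non-isolated
   vertices have degree `≥ 2` (on a "live" vertex set `S` ⊇ support): sum the ball bounds of
   `MooreBoundBalls` over all vertices (odd girth `2r+1`) or all darts (even girth `2r`) and
   insert the walk-count inequality of `MooreBoundCount`; this gives `|S| ≥ n₀(d̄, g)` for the
   average degree `d̄ = 2|E|/|S|` (the paper's `n ≥ n₀(Λ+1, g) ≥ n₀(d̄, g)`).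
2. `egirth_deleteIncidenceSet_of_degree_le_one` and `AlonHooryLinial.mooreBound_le_of_card_eq`
   — the peeling induction of the first paragraph of the proof: removing a vertex of degree `< 2`
   (here: its at most one edge, the vertex type being fixed) keeps the girth and, since `d ≥ 2`,
   the hypothesis `d·|S| ≤ 2|E|`; with `mooreBound_mono` (monotonicity of `n₀` in `d`) and the
   closed forms `mooreBound_odd`, `mooreBound_even`.
3. `AlonHooryLinial.mooreBound_le_card_of_egirth_eq` — `S = univ`.

The named fact `alonHooryLinial_mooreBound` of `MooreBound.lean` is the special case `V = Fin n`
(checked by the closing `example`); its discharge `alonHooryLinial_mooreBound_holds` lives in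
`MooreBoundIrregular.lean` (an independent formalization via short paths, landed first), so it is
deliberately NOT restated here.

## References

* N. Alon, S. Hoory, N. Linial, The Moore bound for irregular graphs, *Graphs Combin.* 18
  (2002) 53–57, Theorem 1 [AlonHooryLinial2002].
-/

namespace Literature.Combinatorics.SimpleGraph

open _root_.SimpleGraph Finset AlonHooryLinial

/-- The Moore bound `n₀(d, g)` is monotone in `d ≥ 1`. [cite: AlonHooryLinial2002, p. 54] -/
theorem mooreBound_mono {d d' : ℝ} (hd : 1 ≤ d) (hdd' : d ≤ d') (g : ℕ) :
    mooreBound d g ≤ mooreBound d' g := by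
  have hs : ∑ i ∈ range (g / 2), (d - 1) ^ i ≤ ∑ i ∈ range (g / 2), (d' - 1) ^ i :=
    sum_le_sum fun i _ => pow_le_pow_left₀ (by linarith) (by linarith) i
  have hnn : 0 ≤ ∑ i ∈ range (g / 2), (d - 1) ^ i :=
    sum_nonneg fun i _ => pow_nonneg (by linarith) i
  unfold mooreBound
  split_ifs
  · linarith
  · nlinarith [mul_le_mul hdd' hs hnn (by linarith)]

/-- For `g = 2r + 1`, `n₀(d, g) = 1 + d Σ_{i<r} (d−1)^i`. [cite: AlonHooryLinial2002, p. 53] -/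
theorem mooreBound_odd (d : ℝ) (r : ℕ) :
    mooreBound d (2 * r + 1) = 1 + d * ∑ i ∈ range r, (d - 1) ^ i := by
  have h : (2 * r + 1) / 2 = r := by omega
  unfold mooreBound
  rw [if_neg (Nat.not_even_iff_odd.2 (odd_two_mul_add_one r)), h]

/-- For `g = 2r`, `n₀(d, g) = 2 Σ_{i<r} (d−1)^i`. [cite: AlonHooryLinial2002, p. 53] -/
theorem mooreBound_even (d : ℝ) (r : ℕ) :
    mooreBound d (2 * r) = 2 * ∑ i ∈ range r, (d - 1) ^ i := by
  have h : (2 * r) / 2 = r := by omega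
  unfold mooreBound
  rw [if_pos (even_two_mul r), h]

variable {V : Type*} [Fintype V] [DecidableEq V]

/-- **Theorem 1 of Alon–Hoory–Linial for graphs of minimum degree `≥ 2`** (the heart of the
proof): if every vertex of `S` has degree `≥ 2`, `S` contains all non-isolated vertices and the
girth is `g`, then `|S| ≥ n₀(d̄, g)` for the average degree `d̄ = (Σ_v d_v)/|S|` on `S`.
[cite: AlonHooryLinial2002, Thm 1 and its proof, pp. 54–56] -/
theorem AlonHooryLinial.mooreBound_le_card (H : _root_.SimpleGraph V) [DecidableRel H.Adj]
    (S : Finset V) (hS : ∀ x y, H.Adj x y → x ∈ S) (h2 : ∀ v ∈ S, 2 ≤ H.degree v) {g : ℕ}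
    (hg : H.egirth = g) :
    mooreBound ((∑ v, (H.degree v : ℝ)) / S.card) g ≤ S.card := by
  have hS' : ∀ v, 0 < H.degree v → v ∈ S := fun v hv => by
    obtain ⟨w, hw⟩ := (H.degree_pos_iff_exists_adj v).1 hv
    exact hS v w hw
  have hdeg0 : ∀ v, v ∉ S → H.degree v = 0 := fun v hv => by
    by_contra h
    exact hv (hS' v (Nat.pos_of_ne_zero h))
  -- the graph has a cycle, hence an edge, hence `S` is nonempty
  have hna : ¬ H.IsAcyclic := by
    rw [← egirth_eq_top, hg]
    exact ENat.coe_ne_top g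
  obtain ⟨a, c, hc, -⟩ := exists_egirth_eq_length.2 hna
  have hSne : S.Nonempty := ⟨a, hS a _ (c.adj_snd hc.not_nil)⟩
  set D := ∑ v, (H.degree v : ℝ) with hDdef
  set s : ℝ := (S.card : ℝ) with hsdef
  have hs : 0 < s := by rw [hsdef]; exact_mod_cast hSne.card_pos
  have hDS : D = ∑ v ∈ S, (H.degree v : ℝ) :=
    (sum_subset (subset_univ _) fun v _ hv => by simp [hdeg0 v hv]).symm
  have hDs : 2 * s ≤ D := by
    have : ∑ v ∈ S, (2 : ℝ) ≤ ∑ v ∈ S, (H.degree v : ℝ) :=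
      sum_le_sum fun v hv => by exact_mod_cast h2 v hv
    rw [sum_const, nsmul_eq_mul] at this
    rw [hDS]
    linarith
  have hD : 0 < D := by linarith
  -- the walk-count bound, for every `k`
  have hW : ∀ k, D * (D / s - 1) ^ k ≤ ∑ v, ∑ u ∈ H.neighborFinset v, (nbCount H k u v : ℝ) :=
    fun k => card_mul_pow_le_dartSum S hS' h2 hSne k
  obtain ⟨r, hr | hr⟩ := Nat.even_or_odd' g
  · -- even girth `g = 2r`: balls around edges
    subst hr
    rw [mooreBound_even]
    have hge : (((2 * r : ℕ) : ℕ∞)) ≤ H.egirth := hg ▸ le_rfl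
    -- sum the ball bound over all darts
    have hsum : ∑ v, ∑ u ∈ H.neighborFinset v,
        (∑ k ∈ range r, ((nbCount H k u v : ℝ) + (nbCount H k v u : ℝ)))
          ≤ ∑ v, ∑ u ∈ H.neighborFinset v, s := by
      refine sum_le_sum fun v _ => sum_le_sum fun u hu => ?_
      have := card_ball_even hge S hS ((mem_neighborFinset ..).1 hu).symm
      rw [hsdef]
      exact_mod_cast this
    have hrhs : ∑ v, ∑ u ∈ H.neighborFinset v, s = D * s := by
      simp only [sum_const, nsmul_eq_mul, card_neighborFinset_eq_degree]
      rw [hDdef, sum_mul]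
    have hlhs : ∑ v, ∑ u ∈ H.neighborFinset v,
        (∑ k ∈ range r, ((nbCount H k u v : ℝ) + (nbCount H k v u : ℝ)))
          = ∑ k ∈ range r, ((∑ v, ∑ u ∈ H.neighborFinset v, (nbCount H k u v : ℝ))
              + ∑ v, ∑ u ∈ H.neighborFinset v, (nbCount H k u v : ℝ)) := by
      have step : ∀ v, ∑ u ∈ H.neighborFinset v,
          ∑ k ∈ range r, ((nbCount H k u v : ℝ) + (nbCount H k v u : ℝ))
            = ∑ k ∈ range r, ∑ u ∈ H.neighborFinset v,
                ((nbCount H k u v : ℝ) + (nbCount H k v u : ℝ)) :=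
        fun v => sum_comm
      simp_rw [step]
      rw [sum_comm]
      refine sum_congr rfl fun k _ => ?_
      simp_rw [sum_add_distrib]
      rw [sum_neighborFinset_comm (fun u v => (nbCount H k v u : ℝ))]
    rw [hlhs, hrhs] at hsum
    have hkey : ∑ k ∈ range r, (D * (D / s - 1) ^ k + D * (D / s - 1) ^ k) ≤ D * s :=
      (sum_le_sum fun k _ => add_le_add (hW k) (hW k)).trans hsum
    have : D * (2 * ∑ k ∈ range r, (D / s - 1) ^ k) ≤ D * s := by
      rw [mul_sum, mul_sum]
      calc ∑ k ∈ range r, D * (2 * (D / s - 1) ^ k)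
          = ∑ k ∈ range r, (D * (D / s - 1) ^ k + D * (D / s - 1) ^ k) :=
            sum_congr rfl fun k _ => by ring
        _ ≤ D * s := hkey
    exact le_of_mul_le_mul_left this hD
  · -- odd girth `g = 2r + 1`: balls around vertices
    subst hr
    rw [mooreBound_odd]
    have hge : (((2 * r + 1 : ℕ) : ℕ∞)) ≤ H.egirth := hg ▸ le_rfl
    have hsum : ∑ v ∈ S, (1 + ∑ k ∈ range r, ∑ w ∈ H.neighborFinset v, (nbCount H k v w : ℝ))
        ≤ ∑ v ∈ S, s := by
      refine sum_le_sum fun v hv => ?_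
      have := card_ball_odd hge S hS hv
      rw [hsdef]
      exact_mod_cast this
    rw [sum_const, nsmul_eq_mul, ← hsdef, sum_add_distrib, sum_const, nsmul_eq_mul, mul_one,
      ← hsdef] at hsum
    have hlhs : ∑ v ∈ S, ∑ k ∈ range r, ∑ w ∈ H.neighborFinset v, (nbCount H k v w : ℝ)
        = ∑ k ∈ range r, ∑ v, ∑ u ∈ H.neighborFinset v, (nbCount H k u v : ℝ) := by
      have : ∑ v ∈ S, ∑ k ∈ range r, ∑ w ∈ H.neighborFinset v, (nbCount H k v w : ℝ)
          = ∑ v, ∑ k ∈ range r, ∑ w ∈ H.neighborFinset v, (nbCount H k v w : ℝ) := by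
        refine sum_subset (subset_univ _) fun v _ hv => ?_
        have hN : H.neighborFinset v = ∅ := by
          rw [← card_eq_zero, card_neighborFinset_eq_degree, hdeg0 v hv]
        simp [hN]
      rw [this, sum_comm]
      refine sum_congr rfl fun k _ => ?_
      exact (sum_neighborFinset_comm (fun u v => (nbCount H k u v : ℝ))).symm
    rw [hlhs] at hsum
    have hkey : s + ∑ k ∈ range r, D * (D / s - 1) ^ k ≤ s * s :=
      (add_le_add le_rfl (sum_le_sum fun k _ => hW k)).trans hsum
    have : s * (1 + D / s * ∑ k ∈ range r, (D / s - 1) ^ k) ≤ s * s := by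
      calc s * (1 + D / s * ∑ k ∈ range r, (D / s - 1) ^ k)
          = s + ∑ k ∈ range r, D * (D / s - 1) ^ k := by
            rw [mul_sum, mul_add, mul_one, mul_sum]
            congr 1
            refine sum_congr rfl fun k _ => ?_
            field_simp
        _ ≤ s * s := hkey
    exact le_of_mul_le_mul_left this hs

omit [DecidableEq V] in
/-- Deleting the (at most one) edge at a vertex of degree `≤ 1` does not change the girth: such an
edge lies on no cycle. [cite: AlonHooryLinial2002, §proof of Thm 1, p. 54] -/
theorem egirth_deleteIncidenceSet_of_degree_le_one (G : _root_.SimpleGraph V) [DecidableRel G.Adj]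
    (v : V) (hv : G.degree v ≤ 1) : (G.deleteIncidenceSet v).egirth = G.egirth := by
  refine le_antisymm ?_ (egirth_anti (G.deleteIncidenceSet_le v))
  by_cases hna : G.IsAcyclic
  · rw [egirth_eq_top.2 hna]
    exact le_top
  obtain ⟨a, c, hc, hcl⟩ := exists_egirth_eq_length.2 hna
  have hedges : ∀ e, e ∈ c.edges → e ∉ G.incidenceSet v := by
    intro e he hinc
    have hvc : v ∈ c.support := Walk.mem_support_of_mem_edges he hinc.2
    have h2 := Walk.IsCycle.ncard_neighborSet_toSubgraph_eq_two hc hvc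
    have hsub : c.toSubgraph.neighborSet v ⊆ G.neighborSet v :=
      c.toSubgraph.neighborSet_subset v
    have hle := Set.ncard_le_ncard hsub (Set.toFinite _)
    rw [h2, Set.ncard_eq_toFinset_card' (G.neighborSet v), ← neighborFinset_def,
      card_neighborFinset_eq_degree] at hle
    omega
  rw [hcl]
  have hc' := Walk.IsCycle.toDeleteEdges G (G.incidenceSet v) hc hedges
  have := egirth_le_length hc'
  rwa [Walk.length_transfer] at this

/-- **The peeling induction** (Alon–Hoory–Linial, first paragraph of the proof): deleting vertices
of degree `< 2` one at a time keeps the girth and does not decrease the average degree (as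
`d ≥ 2`), so the bound for minimum degree `≥ 2` gives the general one.
[cite: AlonHooryLinial2002, §proof of Thm 1, p. 54] -/
theorem AlonHooryLinial.mooreBound_le_of_card_eq (g : ℕ) {d : ℝ} (hd : 2 ≤ d) :
    ∀ (m : ℕ) (G : _root_.SimpleGraph V) (S : Finset V), S.card = m →
      (∀ x y, G.Adj x y → x ∈ S) → G.egirth = g → d * m ≤ 2 * (G.edgeSet.ncard : ℝ) →
      mooreBound d g ≤ m := by
  intro m
  induction m with
  | zero =>
    intro G S hSm hS hg _
    have hna : ¬ G.IsAcyclic := by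
      rw [← egirth_eq_top, hg]
      exact ENat.coe_ne_top g
    obtain ⟨a, c, hc, -⟩ := exists_egirth_eq_length.2 hna
    have := hS a _ (c.adj_snd hc.not_nil)
    rw [card_eq_zero.1 hSm] at this
    simp at this
  | succ m ih =>
    intro G S hSm hS hg hdm
    classical
    by_cases hlow : ∃ v ∈ S, G.degree v ≤ 1
    · obtain ⟨v, hvS, hv⟩ := hlow
      set G' := G.deleteIncidenceSet v with hG'
      have hS' : ∀ x y, G'.Adj x y → x ∈ S.erase v := fun x y h => by
        rw [hG', deleteIncidenceSet_adj] at h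
        exact mem_erase.2 ⟨h.2.1, hS x y h.1⟩
      have hg' : G'.egirth = g := by
        rw [hG', egirth_deleteIncidenceSet_of_degree_le_one G v hv, hg]
      have hE : (G.edgeSet.ncard : ℝ) - 1 ≤ (G'.edgeSet.ncard : ℝ) := by
        have h1 : G'.edgeFinset.card = G.edgeFinset.card - G.degree v :=
          G.card_edgeFinset_deleteIncidenceSet v
        have h2 : G.degree v ≤ G.edgeFinset.card := G.degree_le_card_edgeFinset v
        rw [← coe_edgeFinset, ← coe_edgeFinset, Set.ncard_coe_finset, Set.ncard_coe_finset, h1,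
          Nat.cast_sub h2]
        have : (G.degree v : ℝ) ≤ 1 := by exact_mod_cast hv
        linarith
      have hcard : (S.erase v).card = m := by
        rw [card_erase_of_mem hvS, hSm]
        rfl
      have hdm' : d * m ≤ 2 * (G'.edgeSet.ncard : ℝ) := by
        push_cast at hdm
        nlinarith
      have := ih G' (S.erase v) hcard hS' hg' hdm'
      push_cast
      linarith [this]
    · push Not at hlow
      have h2 : ∀ v ∈ S, 2 ≤ G.degree v := fun v hv => hlow v hv
      have hcore := AlonHooryLinial.mooreBound_le_card G S hS h2 hg
      rw [hSm] at hcore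
      have hD : (∑ v, (G.degree v : ℝ)) = 2 * (G.edgeSet.ncard : ℝ) := by
        rw [← coe_edgeFinset, Set.ncard_coe_finset]
        exact_mod_cast G.sum_degrees_eq_twice_card_edges
      have hm : (0 : ℝ) < (m + 1 : ℕ) := by exact_mod_cast Nat.succ_pos m
      have hle : d ≤ (∑ v, (G.degree v : ℝ)) / (m + 1 : ℕ) := by
        rw [hD, le_div_iff₀ hm]
        exact hdm
      exact (mooreBound_mono (by linarith) hle g).trans hcore

/-- **Alon–Hoory–Linial, Theorem 1, on an arbitrary finite vertex type**: a simple graph on `V`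
of girth `g` (`G.egirth = g`) with `d ≥ 2` and `d · |V| ≤ 2|E|` (average degree `≥ d`) has
`n₀(d, g) ≤ |V|`.  The named fact `alonHooryLinial_mooreBound` is the case `V = Fin n`
(discharged in `MooreBoundIrregular.lean`). [cite: AlonHooryLinial2002, Thm 1] -/
theorem AlonHooryLinial.mooreBound_le_card_of_egirth_eq (G : _root_.SimpleGraph V) {g : ℕ}
    (hg : G.egirth = g) {d : ℝ} (hd : 2 ≤ d)
    (hdn : d * (Fintype.card V : ℝ) ≤ 2 * (G.edgeSet.ncard : ℝ)) :
    mooreBound d g ≤ Fintype.card V :=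
  AlonHooryLinial.mooreBound_le_of_card_eq g hd (Fintype.card V) G univ Finset.card_univ
    (fun x _ _ => mem_univ x) hg hdn

/- The named fact of `MooreBound.lean` is the special case `V = Fin n` (its registered discharge
`alonHooryLinial_mooreBound_holds` is in `MooreBoundIrregular.lean`). -/
example : alonHooryLinial_mooreBound := fun n _ _ G hg hd hdn =>
  (Fintype.card_fin n) ▸ AlonHooryLinial.mooreBound_le_card_of_egirth_eq G hg hd
    (by rwa [Fintype.card_fin])

end Literature.Combinatorics.SimpleGraph
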